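import Summits.MatrixMultiplication.OmegaCensus.STPP222IcosetClassNoneK6R4Z5
import Summits.MatrixMultiplication.OmegaCensus.STPP222IcosetClassNoneK6
import Summits.MatrixMultiplication.OmegaCensus.STPP222IcosetClassNoneK6Z11
import Summits.MatrixMultiplication.OmegaCensus.STPP222DensityTen

/-!
# ω-census, icoset class, KERNEL capstone below order 96: no involution-coset `(2,2,2)⁶` family in `𝔽₂³ × ℤ_m` or `𝔽₂⁴ × ℤ_m` of order `< 96`

HONEST FRAMING (pub-omega census; verbatim): lottery ticket; floor = certified bounds/negative ranges.
Census STRUCTURE bookkeeping (question Q7; CLASS-INTERNAL negatives, nothing about unrestricted `(2,2,2)⁶` families, nothing about `ω`).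

The kernel cells of the involution-coset class census at `K = 6` below the class onset `96` (`[2,3,4,4]`, `[2,2,2,3,4]`, ENG2), for
elementary 2-parts of rank `3` and `4` and a cyclic odd cofactor, assembled into two quantified statements:
`no_icoset_pow6_F2cube_zmod_lt96` — for every odd `m` with `8m < 96`, `𝔽₂³ × ℤ_m` carries no icoset `(2,2,2)⁶` STPP family — and
`no_icoset_pow6_F2pow4_zmod_lt96` — for every odd `m` with `16m < 96`, `𝔽₂⁴ × ℤ_m` carries none.  Ingredients: the search cells
`m = 7, 9, 11` (seat gen 19: `STPP222IcosetClassNoneK6.lean`, `…Z11.lean`) and `m = 5` at rank four (this seat: `STPP222IcosetClassNoneK6R4Z5.lean`),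
and for the small orders `8, 24, 40, 16, 48` the kernel CUBE DENSITY LAW `10k ≤ |H| + 4` of seat stpp-1 g25 (`CubeNB.ten_mul_le_card_add_four`,
`STPP222DensityTen.lean`; here as `Icoset.no_icoset_pow6_of_card_lt`: no `(2,2,2)⁶` family of 2-sets at all in an abelian group of
order `< 56`).  (Rank `≤ 2` carries no icoset family at all — no independent frame; rank `≥ 5` exceeds `96` except `𝔽₂⁵`, `𝔽₂⁶`, of which
`𝔽₂⁵` is below the density bound and `𝔽₂⁶` (order 64) is NOT covered here; `𝔽₂³ × ℤ₃²` is `STPP222IcosetClassNoneK6Z33.lean`.)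
References: H. Cohn, R. Kleinberg, B. Szegedy, C. Umans, FOCS 2005 (arXiv:math/0511460), Def. 5.1.  Seat pub-omega-kernel-l4 (gen 20), 2026-08-27.
-/

namespace Summit.MatrixMultiplication.OmegaCensus

open Literature.Computability.AlgebraicComplexity Finset

namespace Icoset

/-- **Density exclusion.**  No `(2,2,2)^K` icoset family — indeed no STPP family of 2-sets — lives in a finite abelian `V × H` with
`|V × H| + 4 < 10K` (CUBE DENSITY LAW, seat stpp-1 g25). [cite: CohnKleinbergSzegedyUmans2005, Def. 5.1] -/
theorem no_icoset_of_card_lt {V H : Type*} [AddCommGroup V] [AddCommGroup H] [DecidableEq V] [DecidableEq H] [Fintype V]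
    [Fintype H] {K : ℕ} (hcard : Fintype.card (V × H) + 4 < 10 * K) :
    ¬ ∃ A B C : Fin K → Finset (V × H), IsIcosetFamily A B C ∧ IsSTPP A B C := by
  rintro ⟨A, B, C, hF, hS⟩
  obtain ⟨d, hd, rfl, rfl, rfl⟩ := exists_data_of_isIcosetFamily hF
  have := CubeNB.ten_mul_le_card_add_four hS (fun t => d.card_eq_two hd t)
  omega

end Icoset

/-- **Rank three below 96.**  For every odd `m` with `8m < 96`, `𝔽₂³ × ℤ_m` carries no involution-coset `(2,2,2)⁶` STPP family
(`m = 1, 3, 5` by density; `m = 7, 9, 11` by the kernel searches of seat gen 19). [cite: CohnKleinbergSzegedyUmans2005, Def. 5.1] -/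
theorem no_icoset_pow6_F2cube_zmod_lt96 (m : ℕ) [NeZero m] (hodd : m % 2 = 1) (hlt : 8 * m < 96) :
    ¬ ∃ A B C : Fin 6 → Finset ((ZMod 2 × ZMod 2 × ZMod 2) × ZMod m), Icoset.IsIcosetFamily A B C ∧ IsSTPP A B C := by
  have hm : m < 12 := by omega
  interval_cases m
  · exact (NeZero.ne (0 : ℕ) rfl).elim
  · exact Icoset.no_icoset_of_card_lt (by simp [Fintype.card_prod, ZMod.card])
  · omega
  · exact Icoset.no_icoset_of_card_lt (by simp [Fintype.card_prod, ZMod.card])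
  · omega
  · exact Icoset.no_icoset_of_card_lt (by simp [Fintype.card_prod, ZMod.card])
  · omega
  · exact no_icoset_pow6_F2cube_zmod7
  · omega
  · exact no_icoset_pow6_F2cube_zmod9
  · omega
  · exact no_icoset_pow6_F2cube_zmod11

/-- **Rank four below 96.**  For every odd `m` with `16m < 96`, `𝔽₂⁴ × ℤ_m` carries no involution-coset `(2,2,2)⁶` STPP family
(`m = 1, 3` by density; `m = 5` by this seat's kernel search, `STPP222IcosetClassNoneK6R4Z5.lean`). [cite: CohnKleinbergSzegedyUmans2005, Def. 5.1] -/
theorem no_icoset_pow6_F2pow4_zmod_lt96 (m : ℕ) [NeZero m] (hodd : m % 2 = 1) (hlt : 16 * m < 96) :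
    ¬ ∃ A B C : Fin 6 → Finset ((ZMod 2 × ZMod 2 × ZMod 2 × ZMod 2) × ZMod m), Icoset.IsIcosetFamily A B C ∧ IsSTPP A B C := by
  have hm : m < 6 := by omega
  interval_cases m
  · exact (NeZero.ne (0 : ℕ) rfl).elim
  · exact Icoset.no_icoset_of_card_lt (by simp [Fintype.card_prod, ZMod.card])
  · omega
  · exact Icoset.no_icoset_of_card_lt (by simp [Fintype.card_prod, ZMod.card])
  · omega
  · exact no_icoset_pow6_F2pow4_zmod5

end Summit.MatrixMultiplication.OmegaCensus
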